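import Literature.Probability.LatticeModels.LayeredPlaneRotatorPeriodicSusceptibility
import Literature.Probability.LatticeModels.PlaneRotatorPeriodicSusceptibility
import HarnessLib

/-!
# The Simon–Lieb dichotomy for the LAYERED plane rotator in three dimensions, at every interlayer coupling:
# `χ^{3D,free} < ∞ ⇔` one CUBE number `< 1 ⇔ χ^{3D,per}` bounded; translation invariance on the torus

Topic `Literature/Probability/LatticeModels`. B. Simon, Comm. Math. Phys. **77** (1980) 111, Thm 1.3 (summable
two-point function ⇔ a separating shell sum `< 1` ⇒ exponential decay) [Simon1980CMP]; E. H. Lieb, ibid. 127, eq. (23),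
Theorem 4 and p. 128 (boxes: the finite algorithm; shell–shell bonds in `H_C`) [Lieb1980]; J. Ginibre, Comm. Math.
Phys. **16** (1970) 310, Prop. 3 and Example 4 (monotonicity of rotator correlations in ferromagnetic couplings)
[Ginibre1970]; J. Fröhlich, R. Israel, E. H. Lieb, B. Simon, Comm. Math. Phys. **62** (1978) 1, Thms. 4.6–4.7
(anisotropic Gaussian domination: the long-range-order floor) [FILS1978]; S. Friedli, Y. Velenik (CUP 2017) §3.1
(the torus is invariant under translations) [FriedliVelenik2017]; layered couplings `(J, J, εJ)` of L. L. Liu,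
H. E. Stanley [LiuStanley1972].

`LayeredPlaneRotatorSusceptibility.lean` (free / infinite volume) and `LayeredPlaneRotatorPeriodicSusceptibility.lean`
(the torus) compare the layered rotator `(βJ∥, βJ∥, βJ⊥)` on `ℤ³` with its single layer and prove the converse
direction «summable ⇒ bounded» only at WEAK interlayer coupling (`∃ δ > 0`, slab criterion read from a two-dimensional
box). This file removes the qualifier: the equivalence holds at EVERY `J⊥ ≥ 0`, by running Lieb's finite algorithm with
CUBES `[−R, R]³`.

* §1 **Translation invariance on the torus** (`BondSystem.expectJ_eq_of_automorphism`: a coupling-preserving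
  automorphism of any finite bond system leaves every Gibbs expectation invariant — relabelling `θ ↦ θ ∘ e` preserves the
  Haar measure; `torusXY_expectJ_cosDiff_add_right` for the translations of `torusXY d L`): hence
  `AnisotropicRotator.corr K (x + c) (y + c) = corr K x y`, the periodic susceptibility `χ^{per}_L(x) = ∑_y corr K x y`
  does not depend on `x` (`sum_corr_eq_sum_corr_zero`) and **`plateau_L(K) = χ^{per}_L(0)/L³` exactly**
  (`plateau_eq_sum_corr_zero_div`); so `δ ≤ plateau_L ⇒ δ·L³ ≤ χ^{per}_L(0)` at the ORIGIN
  (`mul_pow_le_sum_corr_zero_of_le_plateau`), and the reflection-positivity floor makes `χ^{3D,per}_L(0)` itself exceed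
  every bound (`torus_susceptibility_zero_unbounded_of_log_floor`).
* §2 **Simon's inequality in infinite volume for anisotropic boxes** (`aboxShellSum_layered_le_sum_shell_infTwoPointLayered`):
  Lieb's number of the reference box `∏[−R_i, R_i]` (shell–shell bonds removed) is at most the shell sum of the
  infinite-volume free two-point function, `S_{Rv}(β; J∥, J⊥) ≤ ∑_{b ∈ shell(Rv)} G^{3D,free,∞}(0, b)` (Griffiths–Ginibre).
  For CUBES `Rv = (R, R, R)` the shell is the sup-sphere `‖b‖_∞ = R` (`aboxShellSum_cube_le_sum_sphere_infTwoPointLayered`);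
  the spheres are disjoint and exhaust `ℤ³`, so a summable `G^{3D,free,∞}(0, ·)` has sphere sums `→ 0` and SOME cube
  number is `< 1` (`exists_cube_lt_one_of_summable_layered`). (The SLABS `(R, R, 1)` of
  `PlaneRotatorLiebSlabCriterion.lean` cannot give this converse: their shell contains the two full layers `ℓ = ±1` of the
  box, whose `G`-sum tends to the positive constant `2∑_{x ∈ ℤ²} G(0, (x, 1))` as `R → ∞`, not to `0`.)
* §3 **One cube number `< 1` ⇒ exponential decay ⇒ summable** (`infTwoPointLayered_le_pow_aboxShellSum`,
  `aIndex_const`, `infTwoPointLayered_le_pow_cube`, `summable_layered_of_cube_lt_one`) and the DICHOTOMY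
  **`summable_layered_iff_exists_cube_lt_one`**: `∑_z G^{3D,free,∞}_{β;J∥,J⊥}(0, z) < ∞ ⇔ ∃ R ≥ 1, S_{(R,R,R)} < 1` —
  Lieb's finite algorithm terminates EXACTLY on a finite free susceptibility, for every `β, J∥, J⊥ ≥ 0` (the
  three-dimensional layered twin of `summable_infTwoPoint_iff`).
* §4 **The periodic object** (`AnisotropicRotator.corr_layered_le_pow_cube`: the torus cube criterion =
  `torusXY_expectJ_cosDiff_le_pow_aboxShellSum` of `AnisotropicPlaneRotatorTorusBoxCriterion.lean` with `Rv = (R,R,R)`;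
  `sum_corr_le_tsum_of_corr_le_pow_cube`; `exists_torus_susceptibility_bound_of_summable_layered`): a summable free
  two-point function bounds `χ^{3D,per}_L(x)` uniformly in `L ≥ 2R + 2` and `x`; with
  `summable_infTwoPointLayered_of_torus_susceptibility_le` of `LayeredPlaneRotatorPeriodicSusceptibility.lean` the other way,
  **`torus_susceptibility_bounded_iff_summable_layered`** holds for ALL `β, J∥, J⊥ ≥ 0`; the plateau is `O(L⁻³)` whenever
  the free two-point function is summable (`plateau_le_of_summable_layered`, `plateau_eventually_le_of_summable_layered`),
  and in the region of the Fröhlich–Israel–Lieb–Simon / Kennedy–Lieb–Shastry floor the free two-point function is NOT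
  summable and EVERY cube number is `≥ 1` (`not_summable_layered_of_log_floor`, `one_le_cube_of_log_floor`: the
  algorithm never terminates in the ordered phase).
* §5 **Every dimension** (`PlaneRotator.summable_infTwoPoint_iff_exists_cube_lt_one`,
  `torusXY_susceptibility_bounded_iff_summable_infTwoPoint`, `torusXY_susceptibility_bounded_iff_exists_cube_lt_one`): for
  the ISOTROPIC free rotator on `ℤ^ν` the finite algorithm with cubes terminates exactly on `χ < ∞`, and the periodic
  susceptibility on `(ℤ/Lℤ)^d` is eventually bounded exactly then — the `ν = 2` restriction of `summable_infTwoPoint_iff` /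
  `torus_susceptibility_bounded_iff_summable_infTwoPoint` removed.

In words (classical layered XY comparison model of the `hubbard-tc` cell, MO-S3 2D→3D grammar): for the layered
comparison model the susceptibility-divergence threshold `T_χ^{3D}(J∥, J⊥)` is ONE boundary-condition-independent object
for every anisotropy — periodic = free = Lieb–Simon finite algorithm with cubes — with `T_LRO^{3D,per} ≤ T_χ^{3D}`,
`T_χ^{3D}(J∥, J⊥) ≥ T_χ^{2D}(J∥)` for every `J⊥ ≥ 0` (`summable_layer_of_summable_layered`), and
`T_χ^{3D} → T_χ^{2D}(J∥)` as `J⊥ → 0` (`summable_layer_iff_summable_layered_weak`).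

## What this is not

Classical comparison model only; statements about susceptibility / long-range-order thresholds of the layered rotator,
not a `T_c`, not a Kosterlitz–Thouless window; every constant `C` below is qualitative in `L` (a lattice sum of a
geometric profile), no number is asserted; nothing electronic.
-/

noncomputable section

open MeasureTheory Finset Filter
open scoped BigOperators Topology

namespace Literature.Probability.LatticeModels

/-! ## §1 Translation invariance: automorphisms of a bond system, translations of the torus -/

namespace BondSystem

variable {V ι : Type*} (G : BondSystem V ι)
variable [Fintype V] [Fintype ι] [MeasurableSpace Circle] [BorelSpace Circle]

/-- **Automorphism invariance of Gibbs expectations.** If `(e, ê)` is an automorphism of the finite bond system `G`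
(`src ∘ ê = e ∘ src`, `tgt ∘ ê = e ∘ tgt`) preserving the couplings `J`, then for every continuous observable `f`,
`⟨f(θ ∘ e)⟩_J = ⟨f⟩_J` (the relabelling `θ ↦ θ ∘ e` preserves the Haar measure of `U(1)^V` and the Gibbs weight).
[cite: FriedliVelenik2017, §3.1 (periodic boundary condition: the torus is invariant under translations); Ginibre1970, Example 4 (plane rotators)] -/
theorem expectJ_eq_of_automorphism {e : V ≃ V} {ehat : ι ≃ ι}
    (hsrc : ∀ a, G.src (ehat a) = e (G.src a)) (htgt : ∀ a, G.tgt (ehat a) = e (G.tgt a))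
    {J : ι → ℝ} (hJ : ∀ a, J (ehat a) = J a) {f : (V → Circle) → ℝ} (hf : Continuous f) :
    G.expectJ J (fun θ => f (fun v => θ (e v))) = G.expectJ J f := by
  have hρm : Measurable fun (θ : V → Circle) (v : V) => θ (e v) :=
    measurable_pi_lambda _ fun v => measurable_pi_apply _
  have hmap : (torusHaar V).map (fun (θ : V → Circle) (v : V) => θ (e v)) = torusHaar V := by
    unfold torusHaar
    exact pi_map_comp_injective _ e.injective
  have transport : ∀ {g : (V → Circle) → ℝ}, Continuous g →
      ∫ θ, g θ ∂torusHaar V = ∫ θ, g (fun v => θ (e v)) ∂torusHaar V := by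
    intro g hg
    conv_lhs => rw [← hmap]
    rw [integral_map hρm.aemeasurable hg.aestronglyMeasurable]
  have hwc : Continuous (G.weightJ J) := G.continuous_weightJ J
  have hw : ∀ θ : V → Circle, G.weightJ J (fun v => θ (e v)) = G.weightJ J θ := fun θ =>
    G.ginibreWeight_comp_equiv hsrc htgt hJ θ
  rw [expectJ_eq, expectJ_eq]
  congr 1
  calc ∫ θ, f (fun v => θ (e v)) * G.weightJ J θ ∂torusHaar V
      = ∫ θ, f (fun v => θ (e v)) * G.weightJ J (fun v => θ (e v)) ∂torusHaar V := by simp_rw [hw]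
    _ = ∫ θ, f θ * G.weightJ J θ ∂torusHaar V := (transport (hf.mul hwc)).symm

end BondSystem

section TorusTranslation

variable {d L : ℕ} [NeZero L] [MeasurableSpace Circle] [BorelSpace Circle]

/-- **Translation invariance of the torus two-point function.** For the nearest-neighbour rotator `torusXY d L` on
`(ℤ/Lℤ)^d` with direction-dependent couplings `K_i` and all sites `x, y, c`:
`⟨cos(θ_{x+c} − θ_{y+c})⟩_{K,L} = ⟨cos(θ_x − θ_y)⟩_{K,L}` (the translation `z ↦ z + c`, `(z, i) ↦ (z + c, i)` is a
coupling-preserving automorphism). [cite: FriedliVelenik2017, §3.1 (periodic boundary condition: the torus is invariant under translations)] -/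
theorem torusXY_expectJ_cosDiff_add_right (K : Fin d → ℝ) (x y c : TorusSite d L) :
    (torusXY d L).expectJ (fun b => K b.2) (cosDiff (x + c) (y + c)) =
      (torusXY d L).expectJ (fun b => K b.2) (cosDiff x y) := by
  have key := (torusXY d L).expectJ_eq_of_automorphism (e := Equiv.addRight c)
    (ehat := Equiv.prodCongr (Equiv.addRight c) (Equiv.refl (Fin d)))
    (fun a => ?_) (fun a => ?_) (J := fun b => K b.2) (fun a => ?_) (continuous_cosDiff x y)
  · exact key
  · obtain ⟨z, i⟩ := a
    rfl
  · obtain ⟨z, i⟩ := a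
    show z + c + Pi.single i 1 = z + Pi.single i 1 + c
    exact add_right_comm _ _ _
  · obtain ⟨z, i⟩ := a
    rfl

end TorusTranslation

namespace AnisotropicRotator

open PlaneRotator Literature.Barriers.CriticalPhenomena Literature.Barriers.CriticalPhenomena.LongRangeIsing

/- As in `AnisotropicPlaneRotatorTorusBoxCriterion.lean` §4–§6: `corr`/`plateau` fix the global Borel structure of `Circle`;
the instance-generic theorems are used at that instance (no local instance variables in this namespace). -/

variable {L : ℕ} [NeZero L]

section Translation

/-- **Translation invariance of the angle-cube two-point function** of the anisotropic rotator on `(ℤ/Lℤ)³`: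
`corr K (x + c) (y + c) = corr K x y`. [cite: FriedliVelenik2017, §3.1 (periodic boundary condition: the torus is invariant under translations)] -/
theorem corr_add_right (K : Fin 3 → ℝ) (x y c : TorusSite 3 L) : corr K (x + c) (y + c) = corr K x y := by
  rw [corr_eq_expectJ, corr_eq_expectJ, torusXY_expectJ_cosDiff_add_right]

/-- `corr K x y = corr K 0 (y − x)`. [cite: FriedliVelenik2017, §3.1 (periodic boundary condition: the torus is invariant under translations)] -/
theorem corr_eq_corr_zero_sub (K : Fin 3 → ℝ) (x y : TorusSite 3 L) : corr K x y = corr K 0 (y - x) := by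
  have h := corr_add_right K 0 (y - x) x
  rw [zero_add, sub_add_cancel] at h
  exact h

/-- **The periodic susceptibility does not depend on the base point**: `∑_y corr K x y = ∑_y corr K 0 y` for every
`x`. [cite: FriedliVelenik2017, §3.1 (periodic boundary condition: the torus is invariant under translations)] -/
theorem sum_corr_eq_sum_corr_zero (K : Fin 3 → ℝ) (x : TorusSite 3 L) :
    ∑ y : TorusSite 3 L, corr K x y = ∑ y : TorusSite 3 L, corr K 0 y := by
  rw [show (∑ y : TorusSite 3 L, corr K x y) = ∑ y : TorusSite 3 L, corr K 0 (y - x) from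
    Finset.sum_congr rfl fun y _ => corr_eq_corr_zero_sub K x y]
  exact Fintype.sum_equiv (Equiv.subRight x) _ _ fun y => rfl

/-- **The plateau is the periodic susceptibility at the origin over the volume**: `plateau_L(K) = χ^{per}_L(0)/L³`,
`χ^{per}_L(0) = ∑_y corr K 0 y`. [cite: FriedliVelenikSMLS2017, (10.39)–(10.42) (the plateau); FriedliVelenik2017, §3.1 (translation invariance)] -/
theorem plateau_eq_sum_corr_zero_div (K : Fin 3 → ℝ) :
    plateau L K = (∑ y : TorusSite 3 L, corr K 0 y) / (L : ℝ) ^ 3 := by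
  have hL0 : (0 : ℝ) < (L : ℝ) := by exact_mod_cast Nat.pos_of_ne_zero (NeZero.ne L)
  have hcard : (Finset.univ : Finset (TorusSite 3 L)).card = L ^ 3 := by
    rw [Finset.card_univ, card_torusSite]
  unfold plateau
  simp_rw [sum_corr_eq_sum_corr_zero K]
  rw [Finset.sum_const, hcard, nsmul_eq_mul]
  push_cast
  field_simp

/-- **A plateau floor is a floor on the susceptibility at the origin**: `δ ≤ plateau_L(K) ⇒ δ·L³ ≤ χ^{per}_L(0)`.
[cite: FriedliVelenikSMLS2017, (10.39)–(10.42) (the plateau)] -/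
theorem mul_pow_le_sum_corr_zero_of_le_plateau {K : Fin 3 → ℝ} {δ : ℝ} (h : δ ≤ plateau L K) :
    δ * (L : ℝ) ^ 3 ≤ ∑ y : TorusSite 3 L, corr K 0 y := by
  have hL0 : (0 : ℝ) < (L : ℝ) := by exact_mod_cast Nat.pos_of_ne_zero (NeZero.ne L)
  rw [plateau_eq_sum_corr_zero_div] at h
  exact (le_div_iff₀ (by positivity)).1 h

/-- **A plateau ceiling of order `L⁻³` is a ceiling on the susceptibility at the origin**:
`plateau_L(K) ≤ C/L³ ⇒ χ^{per}_L(0) ≤ C`. [cite: FriedliVelenikSMLS2017, (10.39)–(10.42) (the plateau)] -/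
theorem sum_corr_zero_le_of_plateau_le_div {K : Fin 3 → ℝ} {C : ℝ} (h : plateau L K ≤ C / (L : ℝ) ^ 3) :
    ∑ y : TorusSite 3 L, corr K 0 y ≤ C := by
  have hL0 : (0 : ℝ) < (L : ℝ) := by exact_mod_cast Nat.pos_of_ne_zero (NeZero.ne L)
  rw [plateau_eq_sum_corr_zero_div, div_le_div_iff_of_pos_right (by positivity)] at h
  exact h

/-- **A uniform row bound is a plateau bound**: `χ^{per}_L(0) ≤ C ⇒ plateau_L(K) ≤ C/L³`.
[cite: FriedliVelenikSMLS2017, (10.39)–(10.42) (the plateau)] -/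
theorem plateau_le_div_of_sum_corr_zero_le {K : Fin 3 → ℝ} {C : ℝ} (h : ∑ y : TorusSite 3 L, corr K 0 y ≤ C) :
    plateau L K ≤ C / (L : ℝ) ^ 3 := by
  have hL0 : (0 : ℝ) < (L : ℝ) := by exact_mod_cast Nat.pos_of_ne_zero (NeZero.ne L)
  rw [plateau_eq_sum_corr_zero_div]
  exact div_le_div_of_nonneg_right h (by positivity)

/-- **The reflection-positivity floor makes the periodic susceptibility AT THE ORIGIN exceed every bound**: for
`0 < K⊥ ≤ K∥` with `1 − (1 + ln(K∥/K⊥)/(2π))/K∥ > 0`, for every `B` and `L₀` there is `L ≥ L₀` with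
`χ^{3D,per}_L(0) = ∑_y corr (K∥, K∥, K⊥) 0 y > B` (tree `torus_susceptibility_unbounded_of_log_floor` + translation
invariance). [cite: FILS1978, Thms. 4.6–4.7 and (4.6)–(4.10) (anisotropic Gaussian domination); KLS1988PRL, eq. (7); FriedliVelenik2017, §3.1 (translation invariance)] -/
theorem torus_susceptibility_zero_unbounded_of_log_floor {Kp Kz : ℝ} (hz : 0 < Kz) (hle : Kz ≤ Kp)
    (hfloor : 0 < 1 - (1 + Real.log (Kp / Kz) / (2 * Real.pi)) / Kp) (B : ℝ) (L₀ : ℕ) :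
    ∃ (L : ℕ) (_ : NeZero L), L₀ ≤ L ∧
      B < ∑ y : TorusSite 3 L, corr (layeredCoupling Kp Kz) 0 y := by
  obtain ⟨L, hL, x, hL₀, hB⟩ := torus_susceptibility_unbounded_of_log_floor hz hle hfloor B L₀
  exact ⟨L, hL, hL₀, by rwa [sum_corr_eq_sum_corr_zero] at hB⟩

end Translation

end AnisotropicRotator

/-! ## §2 Simon's inequality in infinite volume for anisotropic boxes; cubes and spheres -/

namespace PlaneRotator

open Literature.Barriers.CriticalPhenomena Literature.Barriers.CriticalPhenomena.LongRangeIsing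

variable [MeasurableSpace Circle] [BorelSpace Circle]

section Simon

/-- **Simon's form of Lieb's anisotropic box number, in infinite volume.** For `β, J∥, J⊥ ≥ 0` and every radius vector
`Rv`, the box number of the layered reference system `∏[−R_i, R_i]` (couplings `βJ∥/2`, `βJ⊥/2` per ordered bond,
shell–shell bonds removed) is at most the shell sum of the infinite-volume free two-point function:
`S_{Rv}(β; J∥, J⊥) ≤ ∑_{b ∈ box ∖ interior} G^{3D,free,∞}_{β;J∥,J⊥}(0, b)` (Griffiths–Ginibre: restore the shell bonds,
then enlarge the box). [cite: Simon1980CMP, Thm 1.3; Lieb1980, eq. (23) and p. 133 (B–B interactions part of H_C); Ginibre1970, Prop. 3 with Example 4 (plane rotators)] -/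
theorem aboxShellSum_layered_le_sum_shell_infTwoPointLayered {β Jp Jz : ℝ} (hβ : 0 ≤ β) (hp : 0 ≤ Jp)
    (hz : 0 ≤ Jz) (Rv : Fin 3 → ℕ) :
    aboxShellSum (fun x y : Site 3 => β / 2 * layeredCoupling Jp Jz x y) Rv ≤
      ∑ b ∈ (abox Rv).filter (fun b => b ∉ aInterior Rv), infTwoPointLayered β Jp Jz 0 b := by
  classical
  set Jf : Site 3 → Site 3 → ℝ := fun x y => β / 2 * layeredCoupling Jp Jz x y with hJf
  have hJf0 : ∀ x y, 0 ≤ Jf x y := fun x y => mul_nonneg (by positivity) (layeredCoupling_nonneg hp hz x y)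
  have hfull0 : ∀ p : abox Rv × abox Rv, 0 ≤ layeredXYCoupling β Jp Jz (abox Rv) p :=
    layeredXYCoupling_nonneg hβ hp hz (abox Rv)
  -- restore the shell–shell bonds (Ginibre monotonicity in the couplings)
  have hdom : ∀ p : abox Rv × abox Rv, aRefCoupling Jf Rv p ≤ layeredXYCoupling β Jp Jz (abox Rv) p := by
    intro p
    unfold aRefCoupling
    split_ifs with h
    · exact hfull0 p
    · exact le_rfl
  have h0 : (0 : Site 3) ∈ abox Rv := zero_mem_abox Rv
  have hterm : ∀ b : abox Rv, twoPoint (aRefCoupling Jf Rv) (aCentre Rv) b ≤ infTwoPointLayered β Jp Jz 0 b := by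
    intro b
    calc twoPoint (aRefCoupling Jf Rv) (aCentre Rv) b
        ≤ twoPoint (layeredXYCoupling β Jp Jz (abox Rv)) (aCentre Rv) b :=
          twoPoint_mono (aRefCoupling_nonneg hJf0 Rv) hdom _ _
      _ = volTwoPointLayered β Jp Jz (abox Rv) 0 b := by
          rw [volTwoPointLayered_of_mem β Jp Jz h0 b.2]; rfl
      _ ≤ infTwoPointLayered β Jp Jz 0 b := volTwoPointLayered_le_inf hβ hp hz _ _ _
  -- the shell sum over the subtype is the filtered sum over the lattice
  have e1 : (∑ b ∈ aShell Rv, infTwoPointLayered β Jp Jz 0 (b : Site 3)) =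
      ∑ b ∈ (abox Rv).filter (fun b => b ∉ aInterior Rv), infTwoPointLayered β Jp Jz 0 b := by
    rw [aShell, Finset.sum_filter, Finset.sum_filter,
      ← Finset.sum_coe_sort (abox Rv) (fun b : Site 3 =>
        if b ∉ aInterior Rv then infTwoPointLayered β Jp Jz 0 b else 0)]
  calc aboxShellSum Jf Rv = ∑ b ∈ aShell Rv, twoPoint (aRefCoupling Jf Rv) (aCentre Rv) b := rfl
    _ ≤ ∑ b ∈ aShell Rv, infTwoPointLayered β Jp Jz 0 (b : Site 3) := Finset.sum_le_sum fun b _ => hterm b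
    _ = _ := e1

omit [MeasurableSpace Circle] [BorelSpace Circle] in
/-- **The shell of the cube `[−R, R]³` lies on the sup-sphere `‖b‖_∞ = R`.** [cite: Simon1980CMP, Thm 1.3 (B a sphere separating 0 from ∞)] -/
theorem mem_sphere_of_mem_abox_const_of_not_mem_aInterior {ν : ℕ} {R : ℕ} {b : Site ν}
    (hb : b ∈ abox (fun _ : Fin ν => R)) (hb' : b ∉ aInterior (fun _ : Fin ν => R)) : b ∈ sphere ν R := by
  rw [mem_sphere]
  rw [mem_abox] at hb
  rw [mem_aInterior, not_forall] at hb'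
  obtain ⟨i, hi⟩ := hb'
  refine le_antisymm (Site.supNorm_le_iff.2 hb) ?_
  exact (not_lt.1 hi).trans (Site.natAbs_le_supNorm b i)

/-- **Simon's inequality for CUBES**: `S_{(R,R,R)}(β; J∥, J⊥) ≤ ∑_{‖b‖_∞ = R} G^{3D,free,∞}_{β;J∥,J⊥}(0, b)` — the cube's
shell is the sup-sphere of radius `R`. [cite: Simon1980CMP, Thm 1.3; Lieb1980, eq. (23) and notes added in proof] -/
theorem aboxShellSum_cube_le_sum_sphere_infTwoPointLayered {β Jp Jz : ℝ} (hβ : 0 ≤ β) (hp : 0 ≤ Jp)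
    (hz : 0 ≤ Jz) (R : ℕ) :
    aboxShellSum (fun x y : Site 3 => β / 2 * layeredCoupling Jp Jz x y) (fun _ : Fin 3 => R) ≤
      ∑ b ∈ sphere 3 R, infTwoPointLayered β Jp Jz 0 b := by
  classical
  refine (aboxShellSum_layered_le_sum_shell_infTwoPointLayered hβ hp hz _).trans ?_
  refine Finset.sum_le_sum_of_subset_of_nonneg (fun b hb => ?_)
    fun b _ _ => infTwoPointLayered_nonneg hβ hp hz 0 b
  rw [Finset.mem_filter] at hb
  exact mem_sphere_of_mem_abox_const_of_not_mem_aInterior hb.1 hb.2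

omit [MeasurableSpace Circle] [BorelSpace Circle] in
/-- The sphere sums of a non-negative summable function on `ℤ^ν` tend to `0` (partial sums over the boxes converge;
consecutive differences are the sphere sums). [cite: Simon1980CMP, Thm 1.3 (Σ⟨σ₀σ_x⟩ < ∞ ⇒ some sphere sum < 1) — plumbing] -/
theorem tendsto_sum_sphere_of_summable_nonneg {ν : ℕ} {G : Site ν → ℝ} (hG0 : ∀ x, 0 ≤ G x) (hG : Summable G) :
    Tendsto (fun R : ℕ => ∑ b ∈ sphere ν R, G b) atTop (𝓝 0) := by
  classical
  set P : ℕ → ℝ := fun n => ∑ b ∈ box ν n, G b with hP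
  have hPmono : Monotone P := fun n m hnm =>
    Finset.sum_le_sum_of_subset_of_nonneg (box_mono ν hnm) fun b _ _ => hG0 b
  have hPbdd : BddAbove (Set.range P) :=
    ⟨∑' b, G b, by rintro _ ⟨n, rfl⟩; exact hG.sum_le_tsum _ (fun b _ => hG0 b)⟩
  have hPlim : Tendsto P atTop (𝓝 (⨆ n, P n)) := tendsto_atTop_ciSup hPmono hPbdd
  have hdiff : Tendsto (fun n : ℕ => P (n + 1) - P n) atTop (𝓝 0) := by
    have h := (hPlim.comp (tendsto_add_atTop_nat 1)).sub hPlim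
    rw [sub_self] at h
    exact h
  have heq : ∀ n : ℕ, ∑ b ∈ sphere ν (n + 1), G b = P (n + 1) - P n := by
    intro n
    rw [sphere_succ_eq_sdiff, Finset.sum_sdiff_eq_sub (box_mono ν (Nat.le_succ n))]
  rw [← tendsto_add_atTop_iff_nat 1]
  simp_rw [heq]
  exact hdiff

/-- **A finite free susceptibility terminates Lieb's algorithm with cubes**, at every interlayer coupling: if
`∑_z G^{3D,free,∞}_{β;J∥,J⊥}(0, z) < ∞` (`β, J∥, J⊥ ≥ 0`) then `S_{(R,R,R)}(β; J∥, J⊥) < 1` for some `R ≥ 1`.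
[cite: Simon1980CMP, Thm 1.3 (Σ⟨σ₀σ_x⟩ < ∞ ⇒ exponential decay); Lieb1980, p. 128 (φ(β) < 1 for a box)] -/
theorem exists_cube_lt_one_of_summable_layered {β Jp Jz : ℝ} (hβ : 0 ≤ β) (hp : 0 ≤ Jp) (hz : 0 ≤ Jz)
    (hG : Summable fun z : Site 3 => infTwoPointLayered β Jp Jz 0 z) :
    ∃ R : ℕ, 1 ≤ R ∧
      aboxShellSum (fun x y : Site 3 => β / 2 * layeredCoupling Jp Jz x y) (fun _ : Fin 3 => R) < 1 := by
  have hlim := tendsto_sum_sphere_of_summable_nonneg (fun z => infTwoPointLayered_nonneg hβ hp hz 0 z) hG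
  have hev : ∀ᶠ R : ℕ in atTop, ∑ b ∈ sphere 3 R, infTwoPointLayered β Jp Jz 0 b < 1 :=
    hlim.eventually (gt_mem_nhds one_pos)
  obtain ⟨R, hR1, hRlt⟩ := ((eventually_ge_atTop 1).and hev).exists
  exact ⟨R, hR1, (aboxShellSum_cube_le_sum_sphere_infTwoPointLayered hβ hp hz R).trans_lt hRlt⟩

end Simon

/-! ## §3 One cube number `< 1` ⇒ exponential decay ⇒ summable; the dichotomy -/

section Cube

omit [MeasurableSpace Circle] [BorelSpace Circle] in
/-- **The index of a cube is the scaled sup norm**: `aIndex (R, …, R) z = ⌊‖z‖_∞/R⌋`.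
[cite: Simon1980CMP, Thm 1.3 — plumbing; Lieb1980, p. 128 (iteration in steps of a box)] -/
theorem aIndex_const {ν : ℕ} (R : ℕ) (z : Site ν) : aIndex (fun _ : Fin ν => R) z = Site.supNorm z / R := by
  classical
  unfold aIndex Site.supNorm
  refine le_antisymm (Finset.sup_le fun i hi => ?_) ?_
  · exact Nat.div_le_div_right (Finset.le_sup (f := fun i => (z i).natAbs) hi)
  · rcases (Finset.univ : Finset (Fin ν)).eq_empty_or_nonempty with h | h
    · simp [h]
    · obtain ⟨i, hi, heq⟩ := Finset.exists_mem_eq_sup Finset.univ h (fun i => (z i).natAbs)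
      rw [heq]
      exact Finset.le_sup (f := fun i => (z i).natAbs / R) hi

omit [MeasurableSpace Circle] [BorelSpace Circle] in
/-- The layered pair coupling has `ℓ^∞`-range one. [cite: LiuStanley1972, p. 272 (layers (J, J, εJ)) — plumbing] -/
theorem supNorm_sub_le_one_of_layeredCoupling_ne_zero {β Jp Jz : ℝ} {x y : Site 3}
    (hxy : β / 2 * layeredCoupling Jp Jz x y ≠ 0) : Site.supNorm (x - y) ≤ 1 := by
  have h1 : l1Norm (x - y) = 1 := by
    by_contra h
    exact hxy (by unfold layeredCoupling; rw [if_neg h, mul_zero])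
  refine (Site.supNorm_le_iff.2 fun i => ?_).trans h1.le
  exact Finset.single_le_sum (f := fun i => ((x - y) i).natAbs) (fun _ _ => Nat.zero_le _) (Finset.mem_univ i)

omit [MeasurableSpace Circle] [BorelSpace Circle] in
/-- The layered pair coupling is translation invariant. [cite: LiuStanley1972, p. 272 (layers (J, J, εJ)) — plumbing] -/
theorem layeredCoupling_sub_sub (β Jp Jz : ℝ) (t x y : Site 3) :
    β / 2 * layeredCoupling Jp Jz (x - t) (y - t) = β / 2 * layeredCoupling Jp Jz x y := by
  simp only [sub_eq_add_neg, layeredCoupling_add]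

/-- **Lieb's anisotropic box bound in infinite volume**: for `β, J∥, J⊥ ≥ 0`, `R_i ≥ 1` and all `x, y ∈ ℤ³`,
`G^{3D,free,∞}_{β;J∥,J⊥}(x, y) ≤ S_{Rv}(β; J∥, J⊥)^{aIndex Rv (x − y)}` (`twoPoint_le_pow_aboxShellSum` in every box, then the
supremum). [cite: Lieb1980, eq. (23) and p. 128 (boxes; finite algorithm); Simon1980CMP, Thm 1.3] -/
theorem infTwoPointLayered_le_pow_aboxShellSum {β Jp Jz : ℝ} (hβ : 0 ≤ β) (hp : 0 ≤ Jp) (hz : 0 ≤ Jz)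
    {Rv : Fin 3 → ℕ} (hR : ∀ i, 1 ≤ Rv i) (x y : Site 3) :
    infTwoPointLayered β Jp Jz x y ≤
      aboxShellSum (fun u v : Site 3 => β / 2 * layeredCoupling Jp Jz u v) Rv ^ aIndex Rv (x - y) := by
  have hJf0 : ∀ u v : Site 3, 0 ≤ β / 2 * layeredCoupling Jp Jz u v := fun u v =>
    mul_nonneg (by positivity) (layeredCoupling_nonneg hp hz u v)
  refine infTwoPointLayered_le_of_forall_box fun n => ?_
  by_cases h : x ∈ box 3 n ∧ y ∈ box 3 n
  · rw [volTwoPointLayered_of_mem β Jp Jz h.1 h.2]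
    exact twoPoint_le_pow_aboxShellSum (Jf := fun u v : Site 3 => β / 2 * layeredCoupling Jp Jz u v) hJf0
      (fun u v huv => supNorm_sub_le_one_of_layeredCoupling_ne_zero huv) (layeredCoupling_sub_sub β Jp Jz) hR
      (box 3 n) (fun p => rfl) ⟨x, h.1⟩ ⟨y, h.2⟩
  · unfold volTwoPointLayered
    rw [dif_neg h]
    exact pow_nonneg (aboxShellSum_nonneg hJf0 Rv) _

/-- **The cube bound**: `G^{3D,free,∞}_{β;J∥,J⊥}(x, y) ≤ S_{(R,R,R)}^{⌊‖x − y‖_∞/R⌋}` (`R ≥ 1`).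
[cite: Lieb1980, eq. (23) and p. 128 (boxes; finite algorithm); Simon1980CMP, Thm 1.3] -/
theorem infTwoPointLayered_le_pow_cube {β Jp Jz : ℝ} (hβ : 0 ≤ β) (hp : 0 ≤ Jp) (hz : 0 ≤ Jz)
    {R : ℕ} (hR : 1 ≤ R) (x y : Site 3) :
    infTwoPointLayered β Jp Jz x y ≤
      aboxShellSum (fun u v : Site 3 => β / 2 * layeredCoupling Jp Jz u v) (fun _ : Fin 3 => R) ^
        (Site.supNorm (x - y) / R) := by
  rw [← aIndex_const R (x - y)]
  exact infTwoPointLayered_le_pow_aboxShellSum hβ hp hz (fun _ => hR) x y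

/-- **A terminating cube certifies a finite free susceptibility**: if `S_{(R,R,R)}(β; J∥, J⊥) < 1` for some `R ≥ 1` then
`∑_z G^{3D,free,∞}_{β;J∥,J⊥}(0, z) < ∞` (cube decay summed over `ℤ³`, tree `summable_of_le_pow_supNorm_div`).
[cite: Lieb1980, p. 128 (φ(β) < 1 ⇒ exponential decay); Simon1980CMP, Thm 1.3 (exponential decay summed over the lattice)] -/
theorem summable_layered_of_cube_lt_one {β Jp Jz : ℝ} (hβ : 0 ≤ β) (hp : 0 ≤ Jp) (hz : 0 ≤ Jz)
    {R : ℕ} (hR : 1 ≤ R)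
    (hS : aboxShellSum (fun u v : Site 3 => β / 2 * layeredCoupling Jp Jz u v) (fun _ : Fin 3 => R) < 1) :
    Summable fun z : Site 3 => infTwoPointLayered β Jp Jz 0 z := by
  have hS0 : 0 ≤ aboxShellSum (fun u v : Site 3 => β / 2 * layeredCoupling Jp Jz u v) (fun _ : Fin 3 => R) :=
    aboxShellSum_nonneg (fun u v => mul_nonneg (by positivity) (layeredCoupling_nonneg hp hz u v)) _
  refine summable_of_le_pow_supNorm_div hR hS0 hS (C := 1) (fun z => infTwoPointLayered_nonneg hβ hp hz 0 z)
    fun z => ?_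
  rw [one_mul]
  have h := infTwoPointLayered_le_pow_cube hβ hp hz hR 0 z
  rwa [zero_sub, Site.supNorm_neg] at h

/-- **The Simon–Lieb dichotomy for the layered rotator in three dimensions**, at every interlayer coupling
(`β, J∥, J⊥ ≥ 0`): `∑_z G^{3D,free,∞}_{β;J∥,J⊥}(0, z) < ∞ ⇔ ∃ R ≥ 1, S_{(R,R,R)}(β; J∥, J⊥) < 1` — Lieb's finite algorithm
with cubes terminates EXACTLY on a finite free susceptibility (the three-dimensional layered twin of
`summable_infTwoPoint_iff`). [cite: Simon1980CMP, Thm 1.3; Lieb1980, Theorem 4 and p. 128 (boxes; finite algorithm)] -/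
theorem summable_layered_iff_exists_cube_lt_one {β Jp Jz : ℝ} (hβ : 0 ≤ β) (hp : 0 ≤ Jp) (hz : 0 ≤ Jz) :
    (Summable fun z : Site 3 => infTwoPointLayered β Jp Jz 0 z) ↔
      ∃ R : ℕ, 1 ≤ R ∧
        aboxShellSum (fun u v : Site 3 => β / 2 * layeredCoupling Jp Jz u v) (fun _ : Fin 3 => R) < 1 :=
  ⟨exists_cube_lt_one_of_summable_layered hβ hp hz,
    fun ⟨_, hR, hS⟩ => summable_layered_of_cube_lt_one hβ hp hz hR hS⟩

/-- **Summable ⇒ exponentially decaying, in all three directions**: if `∑_z G^{3D,free,∞}(0, z) < ∞` then there are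
`R ≥ 1` and `0 ≤ m < 1` with `G^{3D,free,∞}_{β;J∥,J⊥}(x, y) ≤ m^{⌊‖x − y‖_∞/R⌋}` for all `x, y ∈ ℤ³` (`m` the cube number).
[cite: Simon1980CMP, Thm 1.3 (summable ⇒ exponential decay); Lieb1980, Theorem 4 and p. 128] -/
theorem infTwoPointLayered_decay_of_summable {β Jp Jz : ℝ} (hβ : 0 ≤ β) (hp : 0 ≤ Jp) (hz : 0 ≤ Jz)
    (hG : Summable fun z : Site 3 => infTwoPointLayered β Jp Jz 0 z) :
    ∃ R : ℕ, 1 ≤ R ∧ ∃ m : ℝ, 0 ≤ m ∧ m < 1 ∧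
      ∀ x y : Site 3, infTwoPointLayered β Jp Jz x y ≤ m ^ (Site.supNorm (x - y) / R) := by
  obtain ⟨R, hR, hS⟩ := exists_cube_lt_one_of_summable_layered hβ hp hz hG
  exact ⟨R, hR, _, aboxShellSum_nonneg (fun u v => mul_nonneg (by positivity) (layeredCoupling_nonneg hp hz u v)) _,
    hS, fun x y => infTwoPointLayered_le_pow_cube hβ hp hz hR x y⟩

/-- **The cube numbers are monotone in `(β J∥, β J⊥)`** (Griffiths–Ginibre): if `βJ∥ ≤ β'J∥'` and `βJ⊥ ≤ β'J⊥'`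
(all non-negative) then `S_{Rv}(β; J∥, J⊥) ≤ S_{Rv}(β'; J∥', J⊥')`. [cite: Ginibre1970, Prop. 3 with Example 4 (plane rotators)] -/
theorem aboxShellSum_layered_mono {β Jp Jz β' Jp' Jz' : ℝ} (hβ : 0 ≤ β) (hp : 0 ≤ Jp) (hz : 0 ≤ Jz)
    (hp' : β * Jp ≤ β' * Jp') (hz' : β * Jz ≤ β' * Jz') (Rv : Fin 3 → ℕ) :
    aboxShellSum (fun u v : Site 3 => β / 2 * layeredCoupling Jp Jz u v) Rv ≤
      aboxShellSum (fun u v : Site 3 => β' / 2 * layeredCoupling Jp' Jz' u v) Rv := by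
  have hJf0 : ∀ u v : Site 3, 0 ≤ β / 2 * layeredCoupling Jp Jz u v := fun u v =>
    mul_nonneg (by positivity) (layeredCoupling_nonneg hp hz u v)
  have hle : ∀ u v : Site 3, β / 2 * layeredCoupling Jp Jz u v ≤ β' / 2 * layeredCoupling Jp' Jz' u v := by
    intro u v
    unfold layeredCoupling
    split_ifs <;> nlinarith
  refine Finset.sum_le_sum fun b _ => twoPoint_mono (aRefCoupling_nonneg hJf0 Rv) (fun p => ?_) _ _
  unfold aRefCoupling
  split_ifs
  · exact le_rfl
  · exact hle _ _

end Cube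

end PlaneRotator

/-! ## §4 The periodic object: `χ^{3D,per}` bounded ⇔ `G^{3D,free,∞}` summable, at every interlayer coupling -/

namespace AnisotropicRotator

open PlaneRotator Literature.Barriers.CriticalPhenomena Literature.Barriers.CriticalPhenomena.LongRangeIsing

variable {L : ℕ} [NeZero L]

section Periodic

/-- **Lieb's CUBE criterion for the periodic layered rotator.** For `β, J∥, J⊥ ≥ 0`, `R ≥ 1`, `L ≥ 2R + 2` and all sites
`x, y` of `(ℤ/Lℤ)³`: `corr (βJ∥, βJ∥, βJ⊥) x y ≤ S_{(R,R,R)}(β; J∥, J⊥)^{aIndex (R,R,R) (coord(x − y))}`, the SAME cube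
number that bounds the free model on every finite `Λ ⊂ ℤ³` (tree `torusXY_expectJ_cosDiff_le_pow_aboxShellSum`).
[cite: Lieb1980, eq. (23), Theorem 4 and p. 128 (boxes; finite algorithm); LiuStanley1972, p. 272 (layers (J, J, εJ))] -/
theorem corr_layered_le_pow_cube {β Jp Jz : ℝ} (hβ : 0 ≤ β) (hp : 0 ≤ Jp) (hz : 0 ≤ Jz) {R : ℕ}
    (hR : 1 ≤ R) (hL : 2 * R + 2 ≤ L) (x y : TorusSite 3 L) :
    corr (layeredCoupling (β * Jp) (β * Jz)) x y ≤
      aboxShellSum (fun u v : Site 3 => β / 2 * LongRangeIsing.layeredCoupling Jp Jz u v) (fun _ : Fin 3 => R) ^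
        aIndex (fun _ : Fin 3 => R) (fun i => ((x - y) i).valMinAbs) := by
  rw [corr_eq_expectJ]
  refine torusXY_expectJ_cosDiff_le_pow_aboxShellSum (K := layeredCoupling (β * Jp) (β * Jz))
    (fun i => layeredCoupling_nonneg (mul_nonneg hβ hp) (mul_nonneg hβ hz) i) (Rv := fun _ : Fin 3 => R)
    (fun _ => hR) (fun _ => hL) (Jf := fun u v => β / 2 * LongRangeIsing.layeredCoupling Jp Jz u v)
    (fun u v => mul_nonneg (by positivity) (LongRangeIsing.layeredCoupling_nonneg hp hz u v)) (fun u i => ?_) x y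
  obtain ⟨h1, h2⟩ := pairLayeredCoupling_self_add_single Jp Jz u i
  rw [h1, h2, layeredCoupling_mul]
  constructor <;> exact le_of_eq (by ring)

/-- **Row sums from a pointwise cube bound**: if `corr K x y ≤ m^{aIndex (R,R,R) (coord(x − y))}` for all `x, y` with
`0 ≤ m < 1` (`R ≥ 1`), then every row of the periodic susceptibility is `≤ ∑_{z ∈ ℤ³} m^{⌊‖z‖_∞/R⌋}` (box coordinates are
injective; tree `summable_pow_supNorm_div`). [cite: Simon1980CMP, Thm 1.3 (exponential decay summed over the lattice)] -/
theorem sum_corr_le_tsum_of_corr_le_pow_cube {K : Fin 3 → ℝ} {R : ℕ} (hR : 1 ≤ R) {m : ℝ} (hm0 : 0 ≤ m)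
    (hm1 : m < 1)
    (h : ∀ x y : TorusSite 3 L, corr K x y ≤ m ^ aIndex (fun _ : Fin 3 => R) (fun i => ((x - y) i).valMinAbs))
    (x : TorusSite 3 L) :
    ∑ y : TorusSite 3 L, corr K x y ≤ ∑' z : Site 3, m ^ (Site.supNorm z / R) := by
  classical
  have hsum := summable_pow_supNorm_div (ν := 3) hR hm0 hm1
  set τ : TorusSite 3 L → Site 3 := fun y i => ((y - x) i).valMinAbs with hτ
  have hτinj : Function.Injective τ := torusBoxCoord_injective x
  refine (Finset.sum_le_sum fun y _ => h x y).trans ?_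
  have e : ∀ y : TorusSite 3 L, aIndex (fun _ : Fin 3 => R) (fun i => ((x - y) i).valMinAbs) =
      Site.supNorm (τ y) / R := fun y => by
    rw [← aIndex_const R (τ y)]
    exact aIndex_congr_natAbs _ fun i => natAbs_valMinAbs_coord_comm x y i
  simp only [e]
  calc ∑ y : TorusSite 3 L, m ^ (Site.supNorm (τ y) / R)
      = ∑ z ∈ Finset.univ.image τ, m ^ (Site.supNorm z / R) := by
        rw [Finset.sum_image fun y _ z _ h => hτinj h]
    _ ≤ ∑' z : Site 3, m ^ (Site.supNorm z / R) :=
        hsum.sum_le_tsum _ fun z _ => pow_nonneg hm0 _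

/-- **One terminating cube bounds the periodic susceptibility uniformly in the volume**: if
`S_{(R,R,R)}(β; J∥, J⊥) ≤ m < 1` (`R ≥ 1`) then for every `L ≥ 2R + 2` and every site `x`,
`χ^{3D,per}_L(x) ≤ ∑_{z ∈ ℤ³} m^{⌊‖z‖_∞/R⌋}`. [cite: Lieb1980, p. 128 (φ(β) < 1 for a box ⇒ exponential decay); Simon1980CMP, Thm 1.3] -/
theorem sum_corr_le_tsum_of_cube_le {β Jp Jz : ℝ} (hβ : 0 ≤ β) (hp : 0 ≤ Jp) (hz : 0 ≤ Jz) {R : ℕ}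
    (hR : 1 ≤ R) (hL : 2 * R + 2 ≤ L) {m : ℝ}
    (hSm : aboxShellSum (fun u v : Site 3 => β / 2 * LongRangeIsing.layeredCoupling Jp Jz u v)
      (fun _ : Fin 3 => R) ≤ m) (hm1 : m < 1) (x : TorusSite 3 L) :
    ∑ y : TorusSite 3 L, corr (layeredCoupling (β * Jp) (β * Jz)) x y ≤ ∑' z : Site 3, m ^ (Site.supNorm z / R) := by
  have hS0 : 0 ≤ aboxShellSum (fun u v : Site 3 => β / 2 * LongRangeIsing.layeredCoupling Jp Jz u v)
      (fun _ : Fin 3 => R) :=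
    aboxShellSum_nonneg (fun u v => mul_nonneg (by positivity) (LongRangeIsing.layeredCoupling_nonneg hp hz u v)) _
  exact sum_corr_le_tsum_of_corr_le_pow_cube hR (hS0.trans hSm) hm1 (fun x y =>
    (corr_layered_le_pow_cube hβ hp hz hR hL x y).trans (pow_le_pow_left₀ hS0 hSm _)) x

/-- **A summable free two-point function bounds the periodic susceptibility, at EVERY interlayer coupling.** If
`∑_z G^{3D,free,∞}_{β;J∥,J⊥}(0, z) < ∞` (`β, J∥, J⊥ ≥ 0`) then there are `C ≥ 0` and `L₁` (`= 2R + 2` for the terminating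
cube) with `χ^{3D,per}_L(x) ≤ C` for all `L ≥ L₁` and all `x` — no weak-coupling hypothesis.
[cite: Simon1980CMP, Thm 1.3; Lieb1980, eq. (23) and p. 128 (boxes; finite algorithm); Ginibre1970, Prop. 3 with Example 4 (plane rotators)] -/
theorem exists_torus_susceptibility_bound_of_summable_layered {β Jp Jz : ℝ} (hβ : 0 ≤ β) (hp : 0 ≤ Jp)
    (hz : 0 ≤ Jz) (hG : Summable fun z : Site 3 => infTwoPointLayered β Jp Jz 0 z) :
    ∃ (C : ℝ) (L₁ : ℕ), 0 ≤ C ∧ ∀ (L : ℕ) [NeZero L], L₁ ≤ L → ∀ x : TorusSite 3 L,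
      ∑ y : TorusSite 3 L, corr (layeredCoupling (β * Jp) (β * Jz)) x y ≤ C := by
  obtain ⟨R, hR, hS⟩ := exists_cube_lt_one_of_summable_layered hβ hp hz hG
  set m : ℝ := aboxShellSum (fun u v : Site 3 => β / 2 * LongRangeIsing.layeredCoupling Jp Jz u v)
    (fun _ : Fin 3 => R) with hm
  have hm0 : 0 ≤ m :=
    aboxShellSum_nonneg (fun u v => mul_nonneg (by positivity) (LongRangeIsing.layeredCoupling_nonneg hp hz u v)) _
  refine ⟨∑' z : Site 3, m ^ (Site.supNorm z / R), 2 * R + 2, tsum_nonneg fun z => pow_nonneg hm0 _, ?_⟩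
  intro L _ hL x
  exact sum_corr_le_tsum_of_cube_le hβ hp hz hR hL le_rfl hS x

/-- **Boundary-condition independence of the susceptibility transition of the layered rotator, at every interlayer
coupling.** For `β, J∥, J⊥ ≥ 0`: the periodic susceptibility `χ^{3D,per}_L(0)` is eventually bounded in `L` **iff**
`∑_z G^{3D,free,∞}_{β;J∥,J⊥}(0, z) < ∞` (⇐ this file; ⇒ `summable_infTwoPointLayered_of_torus_susceptibility_le`):
`T_χ^{3D,per}(J∥, J⊥) = T_χ^{3D,free}(J∥, J⊥)` = the threshold of Lieb's finite algorithm with cubes — ONE object for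
every anisotropy. [cite: Ginibre1970, Prop. 3 with Example 4 (plane rotators); Simon1980CMP, Thm 1.3; Lieb1980, Theorem 4 and p. 128 (boxes; finite algorithm); FriedliVelenik2017, §3.1 (periodic boxes)] -/
theorem torus_susceptibility_bounded_iff_summable_layered {β Jp Jz : ℝ} (hβ : 0 ≤ β) (hp : 0 ≤ Jp) (hz : 0 ≤ Jz) :
    (∃ (B : ℝ) (L₀ : ℕ), ∀ (L : ℕ) [NeZero L], L₀ ≤ L →
        ∑ y : TorusSite 3 L, corr (layeredCoupling (β * Jp) (β * Jz)) 0 y ≤ B) ↔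
      Summable fun z : Site 3 => infTwoPointLayered β Jp Jz 0 z := by
  constructor
  · rintro ⟨B, L₀, h⟩
    exact (summable_infTwoPointLayered_of_torus_susceptibility_le hβ hp hz h).1
  · intro hG
    obtain ⟨C, L₁, -, h⟩ := exists_torus_susceptibility_bound_of_summable_layered hβ hp hz hG
    exact ⟨C, L₁, fun L _ hL => h L hL 0⟩

/-- **… equivalently, iff one cube terminates**: `χ^{3D,per}_L(0)` eventually bounded `⇔ ∃ R ≥ 1, S_{(R,R,R)} < 1`.
[cite: Lieb1980, Theorem 4 and p. 128 (boxes; finite algorithm); Simon1980CMP, Thm 1.3] -/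
theorem torus_susceptibility_bounded_iff_exists_cube_lt_one {β Jp Jz : ℝ} (hβ : 0 ≤ β) (hp : 0 ≤ Jp)
    (hz : 0 ≤ Jz) :
    (∃ (B : ℝ) (L₀ : ℕ), ∀ (L : ℕ) [NeZero L], L₀ ≤ L →
        ∑ y : TorusSite 3 L, corr (layeredCoupling (β * Jp) (β * Jz)) 0 y ≤ B) ↔
      ∃ R : ℕ, 1 ≤ R ∧
        aboxShellSum (fun u v : Site 3 => β / 2 * LongRangeIsing.layeredCoupling Jp Jz u v) (fun _ : Fin 3 => R) < 1 :=
  (torus_susceptibility_bounded_iff_summable_layered hβ hp hz).trans (summable_layered_iff_exists_cube_lt_one hβ hp hz)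

/-- **No long-range order on the torus where the free susceptibility is finite**: if `∑_z G^{3D,free,∞}_{β;J∥,J⊥}(0, z) < ∞`
then there are `C ≥ 0` and `L₁` with `plateau_L(βJ∥, βJ∥, βJ⊥) ≤ C/L³` for all `L ≥ L₁` — `T_LRO^{3D,per}(J∥, J⊥) ≤
T_χ^{3D}(J∥, J⊥)`; `C` is qualitative (a lattice sum of the cube-decay profile).
[cite: Simon1980CMP, Thm 1.3; FriedliVelenikSMLS2017, (10.39)–(10.42) (the plateau)] -/
theorem plateau_le_of_summable_layered {β Jp Jz : ℝ} (hβ : 0 ≤ β) (hp : 0 ≤ Jp) (hz : 0 ≤ Jz)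
    (hG : Summable fun z : Site 3 => infTwoPointLayered β Jp Jz 0 z) :
    ∃ (C : ℝ) (L₁ : ℕ), 0 ≤ C ∧ ∀ (L : ℕ) [NeZero L], L₁ ≤ L →
      plateau L (layeredCoupling (β * Jp) (β * Jz)) ≤ C / (L : ℝ) ^ 3 := by
  obtain ⟨C, L₁, hC, h⟩ := exists_torus_susceptibility_bound_of_summable_layered hβ hp hz hG
  exact ⟨C, L₁, hC, fun L _ hL => plateau_le_div_of_sum_corr_zero_le (h L hL 0)⟩

/-- **… so the plateau tends to zero**: for every `ε > 0`, `plateau_L ≤ ε` for all large `L`.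
[cite: Simon1980CMP, Thm 1.3; FriedliVelenikSMLS2017, (10.39)–(10.42) (the plateau)] -/
theorem plateau_eventually_le_of_summable_layered {β Jp Jz : ℝ} (hβ : 0 ≤ β) (hp : 0 ≤ Jp) (hz : 0 ≤ Jz)
    (hG : Summable fun z : Site 3 => infTwoPointLayered β Jp Jz 0 z) {ε : ℝ} (hε : 0 < ε) :
    ∃ L₀ : ℕ, ∀ (L : ℕ) [NeZero L], L₀ ≤ L → plateau L (layeredCoupling (β * Jp) (β * Jz)) ≤ ε := by
  obtain ⟨C, L₁, -, h⟩ := plateau_le_of_summable_layered hβ hp hz hG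
  exact plateau_eventually_le_of_le_div h hε

/-- **Torus long-range order forces a divergent free susceptibility**: if the plateau stays `≥ δ > 0` along a sequence of
volumes `L → ∞`, then `∑_z G^{3D,free,∞}_{β;J∥,J⊥}(0, z) = ∞`. [cite: Simon1980CMP, Thm 1.3; FriedliVelenikSMLS2017, (10.39)–(10.42) (the plateau)] -/
theorem not_summable_layered_of_plateau_ge {β Jp Jz : ℝ} (hβ : 0 ≤ β) (hp : 0 ≤ Jp) (hz : 0 ≤ Jz) {δ : ℝ}
    (hδ : 0 < δ)
    (h : ∀ L₀ : ℕ, ∃ (L : ℕ) (_ : NeZero L), L₀ ≤ L ∧ δ ≤ plateau L (layeredCoupling (β * Jp) (β * Jz))) :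
    ¬ Summable fun z : Site 3 => infTwoPointLayered β Jp Jz 0 z := by
  intro hG
  obtain ⟨L₁, hL₁⟩ := plateau_eventually_le_of_summable_layered hβ hp hz hG (half_pos hδ)
  obtain ⟨L, hL, hle, hplat⟩ := h L₁
  have := hL₁ L hle
  linarith

/-- **In the region of the reflection-positivity floor the free susceptibility of the layered rotator diverges**: for
`0 < K⊥ ≤ K∥` with `1 − (1 + ln(K∥/K⊥)/(2π))/K∥ > 0` (tree `layered_longRangeOrder_log`), `∑_z G^{3D,free,∞}(0, z) = ∞`
at `(β, J∥, J⊥) = (1, K∥, K⊥)`. [cite: FILS1978, Thms. 4.6–4.7 and (4.6)–(4.10) (anisotropic Gaussian domination); KLS1988PRL, eq. (7); Simon1980CMP, Thm 1.3] -/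
theorem not_summable_layered_of_log_floor {Kp Kz : ℝ} (hz : 0 < Kz) (hle : Kz ≤ Kp)
    (hfloor : 0 < 1 - (1 + Real.log (Kp / Kz) / (2 * Real.pi)) / Kp) :
    ¬ Summable fun z : Site 3 => infTwoPointLayered 1 Kp Kz 0 z := by
  have hp : 0 ≤ Kp := hz.le.trans hle
  intro hG
  obtain ⟨C, L₁, -, h⟩ := exists_torus_susceptibility_bound_of_summable_layered zero_le_one hp hz.le hG
  obtain ⟨L, hL, hL₁, hB⟩ := torus_susceptibility_zero_unbounded_of_log_floor hz hle hfloor C L₁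
  have h' := h L hL₁ 0
  rw [one_mul, one_mul] at h'
  exact absurd h' (not_le.2 hB)

/-- **… and Lieb's algorithm never terminates there**: every cube number is `≥ 1`,
`S_{(R,R,R)}(1; K∥, K⊥) ≥ 1` for all `R ≥ 1`. [cite: Lieb1980, Theorem 4 and p. 128 (boxes; finite algorithm); FILS1978, Thms. 4.6–4.7; Simon1980CMP, Thm 1.3] -/
theorem one_le_cube_of_log_floor {Kp Kz : ℝ} (hz : 0 < Kz) (hle : Kz ≤ Kp)
    (hfloor : 0 < 1 - (1 + Real.log (Kp / Kz) / (2 * Real.pi)) / Kp) {R : ℕ} (hR : 1 ≤ R) :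
    1 ≤ aboxShellSum (fun u v : Site 3 => 1 / 2 * LongRangeIsing.layeredCoupling Kp Kz u v) (fun _ : Fin 3 => R) := by
  have hp : 0 ≤ Kp := hz.le.trans hle
  by_contra hlt
  exact not_summable_layered_of_log_floor hz hle hfloor
    (summable_layered_of_cube_lt_one zero_le_one hp hz.le hR (not_le.1 hlt))

end Periodic

end AnisotropicRotator

/-! ## §5 Every dimension: the isotropic free rotator on `ℤ^ν` and on the torus `(ℤ/Lℤ)^d`

`PlaneRotatorFreeTwoPoint.lean` proves `summable_infTwoPoint_iff` — `∑_x G_K(0, x) < ∞ ⇔ ∃ R ≥ 1, S_R(K) < 1` — for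
`ν = 2` only (its lattice sum `boxSusceptibilityBound` is two-dimensional), and `PlaneRotatorPeriodicSusceptibility.lean`
inherits the restriction. With Simon's lattice sum `summable_of_le_pow_supNorm_div` (every `ν`) the cube route above gives
both statements in EVERY dimension: for the free nearest-neighbour plane rotator on `ℤ^ν` the Lieb–Simon finite algorithm
with cubes `[−R, R]^ν` terminates exactly when the susceptibility is finite, and the periodic susceptibility on `(ℤ/Lℤ)^d`
is eventually bounded exactly then. -/

namespace PlaneRotator

open Literature.Barriers.CriticalPhenomena Literature.Barriers.CriticalPhenomena.LongRangeIsing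

variable [MeasurableSpace Circle] [BorelSpace Circle]

section EveryDimension

variable {ν : ℕ}

/-- **A terminating cube certifies a finite susceptibility, in every dimension**: if `S_R(K) < 1` for some `R ≥ 1`
(`K ≥ 0`, `S_R = nnBoxShellSum K ν R` the number of the cube `[−R, R]^ν`) then `∑_x G_K(0, x) < ∞` on `ℤ^ν`
(`infTwoPoint_le_pow_nnBoxShellSum` summed with `summable_of_le_pow_supNorm_div`).
[cite: Lieb1980, p. 128 (φ(β) < 1 for a box ⇒ exponential decay); Simon1980CMP, Thm 1.3 (exponential decay summed over the lattice)] -/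
theorem summable_infTwoPoint_of_cube_lt_one {K : ℝ} (hK : 0 ≤ K) {R : ℕ} (hR : 1 ≤ R)
    (hS : nnBoxShellSum K ν R < 1) : Summable fun x : Site ν => infTwoPoint K ν 0 x := by
  have hS0 : 0 ≤ nnBoxShellSum K ν R :=
    boxShellSum_nonneg (fun u v => mul_nonneg (div_nonneg hK zero_le_two) (nnCoupling_nonneg _ _)) R
  refine summable_of_le_pow_supNorm_div hR hS0 hS (C := 1) (fun x => infTwoPoint_nonneg hK 0 x) fun x => ?_
  rw [one_mul]
  have h := infTwoPoint_le_pow_nnBoxShellSum (ν := ν) hK hR 0 x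
  rwa [zero_sub, Site.supNorm_neg] at h

/-- **Lieb's finite algorithm terminates exactly on the phase of finite susceptibility, in every dimension** (`K ≥ 0`):
`∑_x G_K(0, x) < ∞ ⇔ ∃ R ≥ 1, S_R(K) < 1` on `ℤ^ν` (⇒: Simon's telescoping over the sup-spheres,
`exists_nnBoxShellSum_lt_one_of_summable`; ⇐: `summable_infTwoPoint_of_cube_lt_one`).
[cite: Lieb1980, p. 128 (boxes: "one can, in principle, compute β_c to arbitrary accuracy"); Simon1980CMP, Thm 1.3] -/
theorem summable_infTwoPoint_iff_exists_cube_lt_one {K : ℝ} (hK : 0 ≤ K) :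
    (Summable fun x : Site ν => infTwoPoint K ν 0 x) ↔ ∃ R : ℕ, 1 ≤ R ∧ nnBoxShellSum K ν R < 1 :=
  ⟨exists_nnBoxShellSum_lt_one_of_summable hK, fun ⟨_, hR, hS⟩ => summable_infTwoPoint_of_cube_lt_one hK hR hS⟩

/-- **The finite-susceptibility phase is a down-set in `K`, in every dimension** (Griffiths–Ginibre on the cube numbers):
`0 ≤ K ≤ K'` and `∑_x G_{K'}(0, x) < ∞` ⇒ `∑_x G_K(0, x) < ∞`. [cite: Ginibre1970, Prop. 3 with Example 4 (plane rotators); Simon1980CMP, Thm 1.3] -/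
theorem summable_infTwoPoint_of_le_of_summable {K K' : ℝ} (hK : 0 ≤ K) (hKK' : K ≤ K')
    (hG : Summable fun x : Site ν => infTwoPoint K' ν 0 x) : Summable fun x : Site ν => infTwoPoint K ν 0 x := by
  obtain ⟨R, hR, hS⟩ := exists_nnBoxShellSum_lt_one_of_summable (hK.trans hKK') hG
  exact summable_infTwoPoint_of_cube_lt_one hK hR ((nnBoxShellSum_mono hK hKK' ν R).trans_lt hS)

end EveryDimension

end PlaneRotator

section TorusEveryDimension

open PlaneRotator Literature.Barriers.CriticalPhenomena Literature.Barriers.CriticalPhenomena.LongRangeIsing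

variable {d : ℕ} [MeasurableSpace Circle] [BorelSpace Circle]

/-- **Boundary-condition independence of the susceptibility transition, in every dimension.** For the nearest-neighbour
plane rotator at coupling `K ≥ 0`: the periodic susceptibility `χ^{per}_L(K) = ∑_y ⟨cos(θ_0 − θ_y)⟩_{K,L}` on `(ℤ/Lℤ)^d` is
eventually bounded in `L` **iff** the infinite-volume free two-point function is summable (⇒: Ginibre, free boxes inside
tori, `summable_infTwoPoint_of_torus_susceptibility_le`; ⇐: a terminating cube and the torus box criterion with the same
number, `sum_torusXY_expectJ_cosDiff_le_tsum`) — the `d`-dimensional form of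
`torus_susceptibility_bounded_iff_summable_infTwoPoint`. [cite: Ginibre1970, Prop. 3 with Example 4 (plane rotators); Lieb1980, Theorem 4 and p. 128 (boxes; finite algorithm); Simon1980CMP, Thm 1.3; FriedliVelenik2017, §3.1 (periodic boxes)] -/
theorem torusXY_susceptibility_bounded_iff_summable_infTwoPoint {K : ℝ} (hK : 0 ≤ K) :
    (∃ (B : ℝ) (L₀ : ℕ), ∀ (L : ℕ) [NeZero L], L₀ ≤ L →
        ∑ y : TorusSite d L, (torusXY d L).expectJ (fun _ => K) (cosDiff 0 y) ≤ B) ↔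
      Summable fun x : Site d => infTwoPoint K d 0 x := by
  constructor
  · rintro ⟨B, L₀, h⟩
    exact (summable_infTwoPoint_of_torus_susceptibility_le hK h).1
  · intro hG
    obtain ⟨R, hR, hS⟩ := exists_nnBoxShellSum_lt_one_of_summable hK hG
    refine ⟨∑' z : Site d, nnBoxShellSum K d R ^ (Site.supNorm z / R), 2 * R + 2, fun L _ hL => ?_⟩
    exact sum_torusXY_expectJ_cosDiff_le_tsum hK hR hL le_rfl hS 0

/-- **… iff Lieb's finite algorithm with cubes terminates**, in every dimension: `χ^{per}_L(K)` on `(ℤ/Lℤ)^d` eventually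
bounded `⇔ ∃ R ≥ 1, S_R(K) < 1`. [cite: Lieb1980, Theorem 4 and p. 128 (boxes; finite algorithm); Simon1980CMP, Thm 1.3] -/
theorem torusXY_susceptibility_bounded_iff_exists_cube_lt_one {K : ℝ} (hK : 0 ≤ K) :
    (∃ (B : ℝ) (L₀ : ℕ), ∀ (L : ℕ) [NeZero L], L₀ ≤ L →
        ∑ y : TorusSite d L, (torusXY d L).expectJ (fun _ => K) (cosDiff 0 y) ≤ B) ↔
      ∃ R : ℕ, 1 ≤ R ∧ nnBoxShellSum K d R < 1 := by
  rw [torusXY_susceptibility_bounded_iff_summable_infTwoPoint hK, summable_infTwoPoint_iff_exists_cube_lt_one hK]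

end TorusEveryDimension

end Literature.Probability.LatticeModels

end
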